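import Literature.IUT.HodgeTheaters.FKitCoreBridgeWitness
import Literature.IUT.HodgeTheaters.HodgeTheaterModelFKitCor56iLaws
import HarnessLib

/-!
# [IUTchI] Cor 5.6 (i): the canonical identification (ε) of Def 3.6 (c) at the reference Θ-Hodge theater does
# NOT give it for every Θ-Hodge theater of the kit — a kernel witness (proof-only; 0 definitions)

S. Mochizuki, *Inter-universal Teichmüller theory I*, kurims manuscript (May 2020), §5, Corollary 5.6 (i), statement
p. 153 l. 67–70, proof p. 154 l. 8–24; Definition 3.6 (c) p. 87; Remark 5.2.1 (ii) p. 143 ([IUTchI] Cor 5.6 (i) p.153)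
[claim: Mochizuki2012, status: disputed] (D-0012 claim key; nothing of the series is asserted, no side is taken on
[IUTchIII] Cor. 3.12).

Proof-only file of the abc-iut cell (node IUTchI:Cor5.6(i); seat abc-iut-w5-d217, author lineage of
`HodgeTheaterModelFKitCor56iLaws.lean` p424893 and `FKitCoreBridgeCanonical.lean` p427470/p428577), written for the
layer-5 certificate `Summits/ABC/IUTFork/Conditional/Layer5OfS.lean` (p430789) and abc-iut-L5-d5's flag F-d5-1 /
abc-iut-L5-lead's CORRECTION OF RECORD (2026-08-26T07:35:42Z).

WHAT IS SHOWN.  The certificate's conjunct `layer5_held_cor56i` (v0) carries the binder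
`hcan : ∀ H : FK.ThetaHT, H.IsCanonical` («every Θ-Hodge theater of the ℱ-kit is canonically framed», the strength
of abc-iut-L5-lead's RULINGS #33 (3) ruling (a)), whereas the countersigned conjunct of record (v0.2,
`layer5_held_cor56i_ref`, closer `S5Local.FKitCore.cor56i_of_canonical_laws_ref`) carries
`hHT : (fc.ht S.HT).IsCanonical` («the reference theater is canonically framed», ruling (b); equivalently, by
`FKitCore.isCanonical_ht_of_ref`, (ε) on the IMAGE of `fc.ht`).  Here we prove in the kernel that `hcan` is STRICTLY
STRONGER: over abc-iut-L5-t3's §5-R4 stub `thickS5Local` / `thickCore` (KIT-RULE inhabitant, `FKitCoreBridgeWitness.lean`)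
there is an `ℱ`-kit `FK` and a core agreement `fc` such that ALL the other binders of the conjunct hold —
`Function.Bijective c.e`, L02 `ThToFBijOnGood`, Cor 5.3 (ii) `IsomFtoDBijective`, Cor 5.3 (iv) `AutTemperedBijective`,
rigidity `RlfIsoFaithful`, functoriality `RlfOfNatural` — the reference theater AND every theater in the image of
`fc.ht` are canonical, the node statement `S5Local.Cor56i S` HOLDS (abc-iut-L5-t3's `thick_cor56i`), and yet NOT every
Θ-Hodge theater of the kit is canonical; moreover row L03b `RlfIsoLifts` and the all-framings statement `Cor56iKit`
(ruling (a)) FAIL there.  So, with all laws in place: (ε)-at-the-reference ⇏ (ε)-for-all, and ruling (b) ⇏ ruling (a).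

THE KIT (built inside the proof, no definitions): `ℱ_v`-, `ℱ̲_v`-data = isomorphs of `𝒟_v` with the inclusion as
base functor (as in `FKit.ofBase`); the `ℱ^⊢_v`-ambient is the one-object groupoid `SingleObj ℤˣ` reached through the
CONSTANT functor (mono-analyticisation forgets everything; `ℱ^⊢_v` keeps the automorphism `−1`); the `𝔉^⊩`-ambient is
the one-object category `SingleObj Unit` (so rigidity and functoriality hold trivially).  A Θ-Hodge theater of this kit
is canonical iff all its Def 3.6 (c) framings `rlf_fm v` are `+1`; `fc.ht` frames by `+1`; the theater framed by `−1`
is a kit theater admitting no isomorphism from the reference theater (the image of `fc.ht` is one connected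
component of a disconnected groupoid of kit theaters — abc-iut-L5-d5's point (b): `fc.ht` is not essentially
surjective).  Honest scope: a statement about the TYPED predicates (which assumption labels imply which), not about
print's kit; typed ≠ proved for the genuine instance.
-/

namespace Literature.IUT.HodgeTheaters

open CategoryTheory

namespace PMBaseKit

variable {l : ℕ} (K : PMBaseKit.{0} l) [Fact l.Prime] (hl5 : 5 ≤ l) (hdis : Disjoint K.bad K.arc)
  (hbad : K.bad.Nonempty)

/-- **(ε) at the reference theater ⇏ (ε) for every kit theater, with all laws of `layer5_held_cor56i` in place.**
Over abc-iut-L5-t3's §5-R4 stub `thickS5Local` with its core agreement `thickCore` (index comparison the identity) and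
ANY multiplicative kit, there are an `ℱ`-kit `FK` and an `FKitCore` `fc` such that L02, Cor 5.3 (ii), Cor 5.3 (iv),
rigidity `RlfIsoFaithful` and functoriality `RlfOfNatural` hold, the reference theater `fc.ht S.HT` and every `fc.ht X`
are canonically framed, but some Θ-Hodge theater of the kit is NOT canonically framed, row L03b `RlfIsoLifts` fails and
the all-framings form `Cor56iKit` of Cor 5.6 (i) fails.  PROVED (explicit construction, see the module docstring).
([IUTchI] Cor 5.6 (i) p.153) [claim: Mochizuki2012, status: disputed] -/
theorem thick_exists_fkit_laws_refCanonical_not_forall_isCanonical (M : K.thicken.MultKit) :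
    ∃ (FK : K.thicken.FKit M)
      (fc : (K.thickS5Local hl5 hdis hbad).FKitCore (K.thickCore hl5 hdis hbad) FK),
      FK.ThToFBijOnGood ∧ FK.IsomFtoDBijective ∧ FK.AutTemperedBijective ∧ FK.RlfIsoFaithful ∧
        FK.RlfOfNatural ∧ (fc.ht (K.thickS5Local hl5 hdis hbad).HT).IsCanonical ∧
        (∀ X, (fc.ht X).IsCanonical) ∧ (¬ ∀ H : FK.ThetaHT, H.IsCanonical) ∧
        ¬ FK.RlfIsoLifts ∧ ¬ FK.Cor56iKit := by
  -- the ℱ-kit: `ℱ^⊢_v`-ambient `SingleObj ℤˣ` through the constant functor, `𝔉^⊩`-ambient `SingleObj Unit`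
  let FK : K.thicken.FKit M :=
    { FAmb := fun x => ObjectProperty.FullSubcategory (K.thicken.IsLocal x)
      fModel := fun x => ⟨K.thicken.model x, K.thicken.isLocal_model x⟩
      FmAmb := fun _ => SingleObj ℤˣ
      fmModel := fun _ => SingleObj.star ℤˣ
      toD := fun x => ObjectProperty.ι (K.thicken.IsLocal x)
      toD_model := fun _ => Iso.refl _
      toFm := fun x =>
        (Functor.const (ObjectProperty.FullSubcategory (K.thicken.IsLocal x))).obj (SingleObj.star ℤˣ)
      toFm_model := fun _ => Iso.refl _
      RlfAmb := SingleObj Unit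
      rlfModel := SingleObj.star Unit
      rlfFm := fun _ => (Functor.const (SingleObj Unit)).obj (SingleObj.star ℤˣ)
      rlfOf := fun _ => SingleObj.star Unit
      rlfOfMap := fun _ => Iso.refl _
      rlfFm_rlfOf := fun _ _ => Iso.refl _
      ThAmb := fun x => ObjectProperty.FullSubcategory (K.thicken.IsLocal x)
      thModel := fun x => ⟨K.thicken.model x, K.thicken.isLocal_model x⟩
      thToF := fun _ => 𝟭 _
      thToF_model := fun _ => Iso.refl _
      toDm := fun _ => M.mono ⟨fun v => K.thicken.model v, fun v => K.thicken.isLocal_model v⟩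
      toDmMap := fun _ => 𝟙 _
      toDm_toFm := fun F hF => ⟨M.monoMap fun v => (ObjectProperty.ι _).mapIso (hF v).some.symm⟩ }
  -- the laws of the list
  have h02 : FK.ThToFBijOnGood := fun _ _ => (Functor.FullyFaithful.id _).isoEquiv.bijective
  have h53ii : FK.IsomFtoDBijective :=
    FKit.isomFtoDBijective_of_fullyFaithful fun x => ObjectProperty.fullyFaithfulι (K.thicken.IsLocal x)
  have h53iv : FK.AutTemperedBijective := fun _ _ =>
    ((Functor.FullyFaithful.id _).comp (ObjectProperty.fullyFaithfulι _)).isoEquiv.bijective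
  have hfaith : FK.RlfIsoFaithful := fun _ _ a b _ => Iso.ext (Subsingleton.elim (α := Unit) a.hom b.hom)
  have hnat : FK.RlfOfNatural := fun _ _ _ _ => rfl
  -- the §5-R4 stub, its core agreement, and the ℱ-level core agreement framing every theater by `+1`
  let S := K.thickS5Local hl5 hdis hbad
  let c := K.thickCore hl5 hdis hbad
  let ht : S.ThetaHT → FK.ThetaHT := fun X =>
    { th := X.of
      th_isModel := fun x => ⟨ObjectProperty.isoMk _ ((X.of x).property.some)⟩
      rlf := SingleObj.star Unit
      rlf_isModel := ⟨Iso.refl _⟩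
      rlf_fm := fun _ => Iso.refl _ }
  let htIso : ∀ X Y : S.ThetaHT, (X ≅ Y) → FKit.ThetaHT.Iso (ht X) (ht Y) := fun X Y φ =>
    { thIso := fun x => Pi.isoApp φ.hom.iso x
      rlfIso := Iso.refl _
      compat := fun _ => rfl }
  have htIso_bij : ∀ X Y : S.ThetaHT, Function.Bijective (htIso X Y) := by
    intro X Y
    constructor
    · intro φ ψ h
      have h' : ∀ x, Pi.isoApp φ.hom.iso x = Pi.isoApp ψ.hom.iso x := fun x =>
        congrFun (congrArg FKit.ThetaHT.Iso.thIso h) x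
      have h'' : φ.hom.iso = ψ.hom.iso := Iso.ext (funext fun x => congrArg Iso.hom (h' x))
      exact Iso.ext (CoreHom.ext h'')
    · rintro ⟨t, r, hc⟩
      refine ⟨Core.isoMk (Pi.isoMk t), FKit.ThetaHT.Iso.ext_of_thIso_rlfIso ?_ ?_⟩
      · funext x
        change Pi.isoApp (Core.isoMk (Pi.isoMk t)).hom.iso x = t x
        rw [Core.isoMk_hom_iso]
        exact Iso.ext rfl
      · exact Iso.ext (Subsingleton.elim (α := Unit) _ _)
  let fc : S.FKitCore c FK :=
    { famb := fun _ => 𝟭 _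
      fambFF := fun _ => Functor.FullyFaithful.id _
      fambModel := fun _ => Iso.refl _
      baseComm := fun _ => Iso.refl _
      ht := ht
      htIso := fun {X Y} φ => htIso X Y φ
      htIso_bijective := htIso_bij
      assocIso := fun _ _ => Iso.refl _
      assoc_natural := fun φ x => by
        change (Pi.isoApp φ.hom.iso x).hom ≫ 𝟙 _ = 𝟙 _ ≫ (Pi.isoApp φ.hom.iso x).hom
        rw [Category.comp_id, Category.id_comp] }
  -- every theater in the image of `fc.ht` is canonical (`c := 𝟙`)
  have hcanX : ∀ X : S.ThetaHT, (fc.ht X).IsCanonical := fun X =>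
    ⟨Iso.refl _, fun x => by
      show 𝟙 (SingleObj.star ℤˣ) ≫ 𝟙 (SingleObj.star ℤˣ) = 𝟙 (SingleObj.star ℤˣ)
      exact Category.comp_id _⟩
  -- the theater framed by `−1`
  obtain ⟨x₀, -⟩ := id hbad
  let neg : (SingleObj.star ℤˣ : SingleObj ℤˣ) ≅ SingleObj.star ℤˣ :=
    ⟨(-1 : ℤˣ), (-1 : ℤˣ), by show (-1 : ℤˣ) * (-1) = 1; rw [neg_mul_neg, mul_one],
      by show (-1 : ℤˣ) * (-1) = 1; rw [neg_mul_neg, mul_one]⟩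
  let H₁ : FK.ThetaHT := fc.ht S.HT
  let H₂ : FK.ThetaHT :=
    { th := fun x => ⟨K.thicken.model x, K.thicken.isLocal_model x⟩
      th_isModel := fun _ => ⟨Iso.refl _⟩
      rlf := SingleObj.star Unit
      rlf_isModel := ⟨Iso.refl _⟩
      rlf_fm := fun _ => neg }
  have hH₂ : ¬ H₂.IsCanonical := by
    rintro ⟨c', hc'⟩
    have h := hc' x₀
    change 𝟙 (SingleObj.star ℤˣ) ≫ 𝟙 (SingleObj.star ℤˣ) = neg.hom at h
    rw [Category.comp_id] at h
    change (1 : ℤˣ) = -1 at h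
    exact absurd h (by decide)
  -- no isomorphism `H₁ ⥲ H₂` has a compatible global component: the framings differ by `−1`
  have hcompat : ∀ (t : ∀ v, H₁.th v ≅ H₂.th v) (r : H₁.rlf ≅ H₂.rlf),
      ¬ FKit.ThetaHT.RlfCompat H₁ H₂ t r := by
    intro t r hr
    have h := hr x₀
    change 𝟙 (SingleObj.star ℤˣ) ≫ neg.hom = 𝟙 (SingleObj.star ℤˣ) ≫ 𝟙 (SingleObj.star ℤˣ) at h
    rw [Category.id_comp, Category.id_comp] at h
    change (-1 : ℤˣ) = 1 at h
    exact absurd h (by decide)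
  have hlifts : ¬ FK.RlfIsoLifts := fun hL => by
    obtain ⟨r, hr⟩ := hL H₁ H₂ fun _ => Iso.refl _
    exact hcompat _ r hr
  have hkit : ¬ FK.Cor56iKit := fun hK => by
    obtain ⟨φ, -⟩ := (hK H₁ H₂).2 fun _ => Iso.refl _
    exact hcompat φ.thIso φ.rlfIso φ.compat
  exact ⟨FK, fc, h02, h53ii, h53iv, hfaith, hnat, hcanX S.HT, hcanX, fun h => hH₂ (h H₂), hlifts, hkit⟩

/-- **At the same witness the node statement holds and all seven binders of `layer5_held_cor56i_ref` are met while
`hcan` fails** — packaged over the prime: for every prime `l ≥ 5` there are `𝔡, S, K, c, M, FK, fc` with `𝔡.l = l`,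
`c.e` bijective (so `he`), L02, Cor 5.3 (ii), (iv), rigidity, functoriality, (ε) at the reference theater (`hHT`) and
on the whole image of `fc.ht`, the FROZEN node statement `BaseThetaDatum.S5Local.Cor56i S` TRUE (abc-iut-L5-t3's
`thick_cor56i`), and `¬ ∀ H, H.IsCanonical`, `¬ RlfIsoLifts`, `¬ Cor56iKit`.  Hence the v0 binder `hcan` of the
layer-5 certificate is strictly stronger than the v0.2 binder `hHT` (F-d5-1), and RULINGS #33 (3) ruling (a) is
strictly stronger than ruling (b), as KERNEL facts about the typed predicates. PROVED.
([IUTchI] Cor 5.6 (i) p.153) [claim: Mochizuki2012, status: disputed] -/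
theorem exists_fKitCore_laws_refCanonical_not_forall_isCanonical (l : ℕ) [Fact l.Prime] (hl5 : 5 ≤ l) :
    ∃ (𝔡 : BaseThetaDatum.{0}) (S : 𝔡.S5Local) (K : PMBaseKit.{0} 𝔡.l) (c : 𝔡.KitCore K) (M : K.MultKit)
      (FK : K.FKit M) (fc : S.FKitCore c FK),
      𝔡.l = l ∧ Function.Bijective c.e ∧ FK.ThToFBijOnGood ∧ FK.IsomFtoDBijective ∧ FK.AutTemperedBijective ∧
        FK.RlfIsoFaithful ∧ FK.RlfOfNatural ∧ (fc.ht S.HT).IsCanonical ∧ (∀ X, (fc.ht X).IsCanonical) ∧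
        BaseThetaDatum.S5Local.Cor56i S ∧
        (¬ ∀ H : FK.ThetaHT, H.IsCanonical) ∧ ¬ FK.RlfIsoLifts ∧ ¬ FK.Cor56iKit := by
  classical
  have hl2 : l ≠ 2 := by omega
  let K : PMBaseKit.{0} l := { toyKit l hl2 with bad := ({PUnit.unit} : Finset Unit), arc := ∅ }
  have hdis : Disjoint K.bad K.arc := Finset.disjoint_empty_right _
  have hbad : K.bad.Nonempty := ⟨PUnit.unit, Finset.mem_singleton_self _⟩
  obtain ⟨FK, fc, h02, h53ii, h53iv, hfaith, hnat, hHT, hcanX, hnot, hlifts, hkit⟩ :=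
    K.thick_exists_fkit_laws_refCanonical_not_forall_isCanonical hl5 hdis hbad (K.thickMultKit hl5 hdis hbad)
  exact ⟨K.thickDatum hl5 hdis hbad, K.thickS5Local hl5 hdis hbad, K.thicken, K.thickCore hl5 hdis hbad,
    K.thickMultKit hl5 hdis hbad, FK, fc, rfl, K.thickCore_e_bijective hl5 hdis hbad, h02, h53ii, h53iv, hfaith,
    hnat, hHT, hcanX, K.thick_cor56i hl5 hdis hbad (K.thickMultKit hl5 hdis hbad), hnot, hlifts, hkit⟩

/-- **F-d5-1 as a refuted schema**: it is FALSE that, for all §5 data with a bijective index comparison, the laws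
L02, Cor 5.3 (ii), Cor 5.3 (iv), `RlfIsoFaithful`, `RlfOfNatural` and the canonical framing of the reference theater
`fc.ht S.HT` (the seven binders of `layer5_held_cor56i_ref`) imply that EVERY Θ-Hodge theater of the kit is canonically
framed (the binder `hcan` of v0's `layer5_held_cor56i`).  PROVED (witness at `l = 5`).
([IUTchI] Cor 5.6 (i) p.153) [claim: Mochizuki2012, status: disputed] -/
theorem not_forall_isCanonical_of_laws_refCanonical :
    ¬ ∀ (𝔡 : BaseThetaDatum.{0}) (S : 𝔡.S5Local) (K : PMBaseKit.{0} 𝔡.l) (c : 𝔡.KitCore K) (M : K.MultKit)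
        (FK : K.FKit M) (fc : S.FKitCore c FK),
        Function.Bijective c.e → FK.ThToFBijOnGood → FK.IsomFtoDBijective → FK.AutTemperedBijective →
          FK.RlfIsoFaithful → FK.RlfOfNatural → (fc.ht S.HT).IsCanonical → ∀ H : FK.ThetaHT, H.IsCanonical := by
  intro h
  haveI : Fact (Nat.Prime 5) := ⟨Nat.prime_five⟩
  obtain ⟨𝔡, S, K, c, M, FK, fc, -, he, h02, h53ii, h53iv, hfaith, hnat, hHT, -, -, hnot, -, -⟩ :=
    exists_fKitCore_laws_refCanonical_not_forall_isCanonical 5 le_rfl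
  exact hnot (h 𝔡 S K c M FK fc he h02 h53ii h53iv hfaith hnat hHT)

/-- **Ruling (a) ⇍ ruling (b)**: it is FALSE that the (b)-package — L02, Cor 5.3 (ii), (iv), rigidity, functoriality,
hence `Cor56iKitCanonical` by `cor56iKitCanonical_of_laws` — implies the all-framings statement `Cor56iKit` of
Cor 5.6 (i) (ruling (a), REJECTED for the node reading by abc-iut-L5-lead's RULINGS #33 (3)); equivalently row L03b
`RlfIsoLifts` is independent of the (b)-laws.  PROVED (witness at `l = 5`; complements
`not_forall_cor56iKitCanonical_without_faithful` and `HodgeTheaterModel.not_cor56iKitCanonical_unitsLink`).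
([IUTchI] Cor 5.6 (i) p.153) [claim: Mochizuki2012, status: disputed] -/
theorem not_forall_cor56iKit_of_laws :
    ¬ ∀ (𝔡 : BaseThetaDatum.{0}) (K : PMBaseKit.{0} 𝔡.l) (M : K.MultKit) (FK : K.FKit M),
        FK.ThToFBijOnGood → FK.IsomFtoDBijective → FK.AutTemperedBijective → FK.RlfIsoFaithful →
          FK.RlfOfNatural → FK.Cor56iKit := by
  intro h
  haveI : Fact (Nat.Prime 5) := ⟨Nat.prime_five⟩
  obtain ⟨𝔡, S, K, c, M, FK, fc, -, -, h02, h53ii, h53iv, hfaith, hnat, -, -, -, -, -, hkit⟩ :=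
    exists_fKitCore_laws_refCanonical_not_forall_isCanonical 5 le_rfl
  exact hkit (h 𝔡 K M FK h02 h53ii h53iv hfaith hnat)

end PMBaseKit

end Literature.IUT.HodgeTheaters

namespace Literature.IUT.HodgeTheaters

open CategoryTheory

/-! ### What `hcan` adds over `hHT` is EXACTLY row L03b `RlfIsoLifts` (v2, appended)

Given functoriality `RlfOfNatural` and ONE canonically framed theater (e.g. the reference theater `fc.ht S.HT` of
`hHT`), «every Θ-Hodge theater of the kit is canonically framed» is EQUIVALENT to row L03b `RlfIsoLifts` («the global
data extends along the local data», the surjectivity half of RULINGS #33 (3) ruling (a), cf.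
`rlfIsoLifts_iff_component_surjective` of p422823): the binder swap hHT → hcan of the layer-5 certificate v0 adds
precisely L03b, and the witness above is a kit where L03b fails. -/

namespace PMBaseKit.FKit

variable {l : ℕ} {K : PMBaseKit.{0} l} {M : K.MultKit} {FK : K.FKit M}

/-- **L03b + one canonical theater ⇒ every theater canonical** (given functoriality): lift the family of model
isomorphisms `†ℱ̲_v ≅ ℱ̲_v ≅ ‡ℱ̲_v` to a compatible global component by `RlfIsoLifts`, obtaining an isomorphism of
Θ-Hodge theaters onto the canonical one, and transport canonicity along it (`IsCanonical.of_iso`). PROVED.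
([IUTchI] Cor 5.6 (i) p.154) [claim: Mochizuki2012, status: disputed] -/
theorem forall_isCanonical_of_rlfIsoLifts (hnat : FK.RlfOfNatural) (hlift : FK.RlfIsoLifts) {H₀ : FK.ThetaHT}
    (h₀ : H₀.IsCanonical) (H : FK.ThetaHT) : H.IsCanonical := by
  obtain ⟨r, hr⟩ := hlift H H₀ fun v => (H.th_isModel v).some ≪≫ (H₀.th_isModel v).some.symm
  exact ThetaHT.IsCanonical.of_iso hnat ⟨_, r, hr⟩ h₀

/-- **Given functoriality and one canonically framed theater, «all theaters canonical» ⟺ row L03b `RlfIsoLifts`.**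
So the v0 binder `hcan` of the layer-5 certificate is, over the v0.2 binders `hnat` + `hHT`, EXACTLY the extra
assumption L03b (the surjectivity half of ruling (a)); `thick_exists_fkit_laws_refCanonical_not_forall_isCanonical` is
a kit where it fails with every other law in place. PROVED. ([IUTchI] Cor 5.6 (i) p.154) [claim: Mochizuki2012, status: disputed] -/
theorem forall_isCanonical_iff_rlfIsoLifts (hnat : FK.RlfOfNatural) {H₀ : FK.ThetaHT} (h₀ : H₀.IsCanonical) :
    (∀ H : FK.ThetaHT, H.IsCanonical) ↔ FK.RlfIsoLifts :=
  ⟨rlfIsoLifts_of_forall_isCanonical hnat, fun hlift H => forall_isCanonical_of_rlfIsoLifts hnat hlift h₀ H⟩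

end PMBaseKit.FKit

namespace BaseThetaDatum.S5Local.FKitCore

variable {𝔡 : BaseThetaDatum.{0}} {S : S5Local 𝔡} {K : PMBaseKit.{0} 𝔡.l} {c : 𝔡.KitCore K}
  {M : K.MultKit} {FK : K.FKit M}

/-- **The certificate's binder swap, exactly**: for a core agreement `fc` with functoriality, v0's
`hcan : ∀ H, H.IsCanonical` ⟺ v0.2's `hHT : (fc.ht S.HT).IsCanonical` ∧ row L03b `RlfIsoLifts`. PROVED.
([IUTchI] Cor 5.6 (i) p.154) [claim: Mochizuki2012, status: disputed] -/
theorem forall_isCanonical_iff_ref_and_rlfIsoLifts (fc : S.FKitCore c FK) (hnat : FK.RlfOfNatural) :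
    (∀ H : FK.ThetaHT, H.IsCanonical) ↔ (fc.ht S.HT).IsCanonical ∧ FK.RlfIsoLifts :=
  ⟨fun h => ⟨h _, PMBaseKit.FKit.rlfIsoLifts_of_forall_isCanonical hnat h⟩,
    fun h => (PMBaseKit.FKit.forall_isCanonical_iff_rlfIsoLifts hnat h.1).2 h.2⟩

end BaseThetaDatum.S5Local.FKitCore

end Literature.IUT.HodgeTheaters
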